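import Literature.AlgebraicGeometry.HodgeTheory.FermatSurfaceHodgeCharacterTwiceThreeOddNoUnit
import Literature.AlgebraicGeometry.Shioda1982.StandardQuadrupleLetter
import HarnessLib

/-!
# No exceptional quadruple at the levels `m = 2n`, `n` odd, `3 ∥ n`, `n` with a good prime (Aoki 1983, Thm. C; Aoki–Shioda 1983, (𝔅²ₘ)(ii))

Everything PROVED (no named facts, no definitions). The multiset / letter form of
`HodgeTheory/FermatSurfaceHodgeCharacterTwiceThreeOddNoUnit.lean` (`standard_of_isHodge_twice_threeOdd` =
[Aoki1983, Thm. C] at the levels `m = 2n`, `n` odd, `3 ∥ n`, `n ∉ {51, 75}`, `n` carrying a prime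
`p ≥ 11` with `n ≠ 3p` or `p ≥ 5` with `p² ∣ n`; function level), in the vocabulary of
`Shioda1982/ExceptionalQuadruples.lean` ([MeyerNeutsch1981Fermatquadrupel] standard / exceptional
quadruples) and in the letter of the tree's named fact `HodgeTheory.AokiShioda1983_thmB2m_standard`:
* **`isStandardQuadruple_of_twice_threeOdd`**: the multiset of values of an indecomposable primitive
  Hodge character of length `4` and such a level is a unit multiple of `L₁ = (1, K, K+1, 2K−2)`
  (type A), `L₂ = (1, K+1, K+2, 2K−4)` (type B), `K = n`, or `L₃ = (1, K'+1, 2K'+1, 3K'−3)`,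
  `K' = m/3` (type C);
* **`not_isExceptionalQuadruple_twice_threeOdd`**: `Δ(m) = 0` — no Ausnahmequadrupel at these
  levels (the multiset form, the shape of the kernel sweeps `not_isExceptionalQuadruple_N`);
* **`thmB2m_standard_twice_threeOdd`**: the letter of the tree's named fact
  `AokiShioda1983_thmB2m_standard` (`HodgeTheory/FermatSurfaceHodgeCharacterStructure`) at these
  levels: every indecomposable primitive Hodge character is a permutation of `αᵢ`, `βᵢ` (`m = 2d`) or
  `γⱼ` (`m = 3d`) (via `letter_of_isStandardQuadruple`, `StandardQuadrupleLetter.lean`).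
The first levels of this family beyond the kernel sweeps (`m ≤ 180`) are `m = 294, 330, 390, 462, 510,
546, 570, …` (`n = 147, 165, 195, 231, 255, 273, 285`); the levels `m = 6p` are `PicardNumberSixPrime`.

HONEST FRAMING (cell `pub-hfermat`): explicit algebraic cycles for specific Hodge classes on
Fermat/Delsarte varieties; residual open instances listed; no claim on general Hodge. (Surface
classes are algebraic by Lefschetz (1,1); this file restates a proved case of a structure theorem
for `𝔅²ₘ`.)

## References
* [Aoki1983] N. Aoki, Math. Ann. 266 (1983) 23–54, Thm. C and §9.
* [AokiShioda1983] N. Aoki, T. Shioda, Progr. Math. 35 (1983) 1–12, §2 Thm (𝔅²ₘ) (ii).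
* [MeyerNeutsch1981Fermatquadrupel] W. Meyer, W. Neutsch, Math. Ann. 256 (1981) 51–62, (13)–(15)
  p. 53, Tabelle 1 p. 54.
-/

namespace Literature.AlgebraicGeometry.Shioda1982

open Finset Multiset Literature.AlgebraicGeometry.HodgeTheory Literature.AlgebraicGeometry.HodgeTheory.FermatCharacter

section TwiceThreeOdd

variable {n : ℕ} [NeZero n]

omit [NeZero n] in
/-- The multiset of values of a `4`-tuple, listed along four pairwise distinct indices. [folklore] -/
private theorem univ_val_map_eq_of_distinct₆ {X : Type*} (α : Fin 4 → X) (a b c d : Fin 4)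
    (hab : a ≠ b) (hac : a ≠ c) (had : a ≠ d) (hbc : b ≠ c) (hbd : b ≠ d) (hcd : c ≠ d) :
    univ.val.map α = {α a, α b, α c, α d} := by
  classical
  have hc4 : #({a, b, c, d} : Finset (Fin 4)) = 4 := by
    rw [Finset.card_insert_of_notMem (by simp [hab, hac, had]),
      Finset.card_insert_of_notMem (by simp [hbc, hbd]), Finset.card_pair hcd]
  have huniv : (univ : Finset (Fin 4)) = {a, b, c, d} :=
    (Finset.eq_univ_of_card _ (by rw [hc4]; simp)).symm
  rw [huniv, Finset.insert_val, Multiset.ndinsert_of_notMem (by simp [hab, hac, had]),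
    Finset.insert_val, Multiset.ndinsert_of_notMem (by simp [hbc, hbd]), Finset.insert_val,
    Multiset.ndinsert_of_notMem (by simp [hcd]), Finset.singleton_val]
  simp only [Multiset.insert_eq_cons, Multiset.map_cons, Multiset.map_singleton]

/-- A unit of `ℤ/2n` (`3 ∥ n`) maps `K' = 2n/3` to `K'` or `2K'`, according to its residue mod `3`.
[folklore] -/
private theorem unit_mul_twoThird₆ (hn3 : 3 ∣ n) (t : (ZMod (2 * n))ˣ) :
    (t : ZMod (2 * n)) * ((2 * n / 3 : ℕ) : ZMod (2 * n)) = ((2 * n / 3 : ℕ) : ZMod (2 * n)) ∨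
      (t : ZMod (2 * n)) * ((2 * n / 3 : ℕ) : ZMod (2 * n)) = 2 * ((2 * n / 3 : ℕ) : ZMod (2 * n)) := by
  haveI : NeZero (2 * n) := ⟨mul_ne_zero two_ne_zero (NeZero.ne n)⟩
  have h3m : 3 ∣ 2 * n := hn3.mul_left 2
  have hcop : Nat.Coprime (t : ZMod (2 * n)).val (2 * n) := ZMod.val_coe_unit_coprime t
  have hK3 : (3 : ZMod (2 * n)) * ((2 * n / 3 : ℕ) : ZMod (2 * n)) = 0 := by
    have : ((3 * (2 * n / 3) : ℕ) : ZMod (2 * n)) = 0 := by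
      rw [Nat.mul_div_cancel' h3m]; exact ZMod.natCast_self _
    exact_mod_cast this
  have hr : (t : ZMod (2 * n)).val % 3 = 1 ∨ (t : ZMod (2 * n)).val % 3 = 2 := by
    have hne : (t : ZMod (2 * n)).val % 3 ≠ 0 := fun h ↦ by
      have h0 : 3 ∣ (t : ZMod (2 * n)).val := Nat.dvd_of_mod_eq_zero h
      have h31 : 3 ∣ Nat.gcd (t : ZMod (2 * n)).val (2 * n) := Nat.dvd_gcd h0 h3m
      rw [Nat.Coprime.gcd_eq_one hcop] at h31
      exact absurd (Nat.le_of_dvd one_pos h31) (by norm_num)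
    omega
  have key : (t : ZMod (2 * n)) * ((2 * n / 3 : ℕ) : ZMod (2 * n)) =
      (((t : ZMod (2 * n)).val % 3 : ℕ) : ZMod (2 * n)) * ((2 * n / 3 : ℕ) : ZMod (2 * n)) := by
    conv_lhs => rw [← ZMod.natCast_zmod_val (t : ZMod (2 * n)),
      ← Nat.div_add_mod (t : ZMod (2 * n)).val 3]
    push_cast
    linear_combination (((t : ZMod (2 * n)).val / 3 : ℕ) : ZMod (2 * n)) * hK3
  rcases hr with hr | hr
  · left; rw [key, hr]; push_cast; ring
  · right; rw [key, hr]; push_cast; ring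

/-- **No exceptional quadruple at the levels `2n`, `n` odd, `3 ∥ n`, `n ∉ {51, 75}`, `n` with a good
prime:** the multiset of values of a pair-free primitive Hodge character of length `4` and level
`2n` is a standard quadruple — a unit multiple of `L₁ = (1, K, K+1, 2K−2)` (type A, `t = x`;
`x·K = K` for the odd unit `x`), of `L₂ = (1, K+1, K+2, 2K−4)` (type B), `K = n`, or of
`L₃ = (1, K'+1, 2K'+1, 3K'−3)`, `K' = 2n/3` (type C; `x·K' ∈ {K', 2K'}`)
(`standard_of_isHodge_twice_threeOdd`).
[cite: Aoki1983, Thm. C] [cite: MeyerNeutsch1981Fermatquadrupel, (13)–(15) p. 53 (Standardquadrupel)] -/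
theorem isStandardQuadruple_of_twice_threeOdd (hnodd : Odd n) (hn3 : 3 ∣ n) (hn9 : ¬ 9 ∣ n)
    (hn51 : n ≠ 51) (hn75 : n ≠ 75) {p : ℕ} (hp : p.Prime) (hpn : p ∣ n)
    (hbig : (11 ≤ p ∧ n ≠ 3 * p) ∨ (5 ≤ p ∧ p ^ 2 ∣ n))
    {α : Fin 4 → ZMod (2 * n)} (hα : IsHodge α)
    (hind : ∀ i j : Fin 4, i ≠ j → α i + α j ≠ 0) (hprim : ∀ g : ℕ, (∀ i, g ∣ (α i).val) → g = 1) :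
    haveI : NeZero (2 * n) := ⟨mul_ne_zero two_ne_zero (NeZero.ne n)⟩
    IsStandardQuadruple (2 * n) (univ.val.map α) := by
  classical
  haveI : NeZero (2 * n) := ⟨mul_ne_zero two_ne_zero (NeZero.ne n)⟩
  have h2 : 2 ∣ 2 * n := dvd_mul_right 2 n
  have h3 : 3 ∣ 2 * n := hn3.mul_left 2
  have hK : 2 * n / 2 = n := Nat.mul_div_cancel_left n two_pos
  have h2n : (2 : ZMod (2 * n)) * (n : ZMod (2 * n)) = 0 := by
    rw [show (2 : ZMod (2 * n)) = ((2 : ℕ) : ZMod (2 * n)) by norm_cast, ← Nat.cast_mul,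
      ZMod.natCast_self]
  have h3K : (3 : ZMod (2 * n)) * ((2 * n / 3 : ℕ) : ZMod (2 * n)) = 0 := by
    have : ((3 * (2 * n / 3) : ℕ) : ZMod (2 * n)) = 0 := by
      rw [Nat.mul_div_cancel' h3]; exact ZMod.natCast_self _
    exact_mod_cast this
  rcases standard_of_isHodge_twice_threeOdd hnodd hn3 hn9 hn51 hn75 hp hpn hbig hα hprim with
    ⟨i, j, hij, h⟩ | ⟨i₀, j₁, j₂, j₃, h01, h02, h03, h12, h13, h23, hu, e1, e2, e3⟩ |
    ⟨i₀, j₁, j₂, j₃, h01, h02, h03, h12, h13, h23, hu, e1, e2, e3⟩ |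
    ⟨i₀, j₁, j₂, j₃, h01, h02, h03, h12, h13, h23, hu, e1, e2, e3⟩
  · exact absurd h (hind i j hij)
  · -- type A: `{x, -2x, x + n, n} = x · L₁`
    have hxn : (α i₀) * (n : ZMod (2 * n)) = n := by
      have := half_mul_unit h2 hu.unit
      rw [hK, IsUnit.unit_spec] at this
      rw [mul_comm (α i₀)]
      exact this
    refine ⟨hu.unit, Or.inl ⟨h2, Or.inl ?_⟩⟩
    rw [univ_val_map_eq_of_distinct₆ α i₀ j₁ j₂ j₃ h01 h02 h03 h12 h13 h23, e1, e2, e3, stdOne, hK]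
    simp only [Multiset.insert_eq_cons, Multiset.map_cons, Multiset.map_singleton, IsUnit.unit_spec,
      mul_one]
    rw [show α i₀ * ((n : ZMod (2 * n)) + 1) = α i₀ + n by rw [mul_add, hxn, mul_one, add_comm],
      show α i₀ * (2 * (n : ZMod (2 * n)) - 2) = -2 * α i₀ by linear_combination (α i₀) * h2n, hxn]
    simp only [← Multiset.singleton_add]
    abel
  · -- type B: `{x, 2x + n, x + n, -4x} = x · L₂`
    have hxn : (α i₀) * (n : ZMod (2 * n)) = n := by
      have := half_mul_unit h2 hu.unit
      rw [hK, IsUnit.unit_spec] at this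
      rw [mul_comm (α i₀)]
      exact this
    refine ⟨hu.unit, Or.inl ⟨h2, Or.inr ?_⟩⟩
    rw [univ_val_map_eq_of_distinct₆ α i₀ j₁ j₂ j₃ h01 h02 h03 h12 h13 h23, e1, e2, e3, stdTwo, hK]
    simp only [Multiset.insert_eq_cons, Multiset.map_cons, Multiset.map_singleton, IsUnit.unit_spec,
      mul_one]
    rw [show α i₀ * ((n : ZMod (2 * n)) + 1) = α i₀ + n by rw [mul_add, hxn, mul_one, add_comm],
      show α i₀ * ((n : ZMod (2 * n)) + 2) = 2 * α i₀ + n by rw [mul_add, hxn]; ring,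
      show α i₀ * (2 * (n : ZMod (2 * n)) - 4) = -4 * α i₀ by linear_combination (α i₀) * h2n]
    simp only [← Multiset.singleton_add]
    abel
  · -- type C: `{x, x + K', x + 2K', -3x} = x · L₃`, `K' = 2n/3`
    refine ⟨hu.unit, Or.inr ⟨h3, ?_⟩⟩
    rcases unit_mul_twoThird₆ hn3 hu.unit with hxn | hxn <;> rw [IsUnit.unit_spec] at hxn
    · rw [univ_val_map_eq_of_distinct₆ α i₀ j₁ j₂ j₃ h01 h02 h03 h12 h13 h23, e1, e2, e3, stdThree]
      simp only [Multiset.insert_eq_cons, Multiset.map_cons, Multiset.map_singleton, IsUnit.unit_spec,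
        mul_one]
      rw [show α i₀ * (((2 * n / 3 : ℕ) : ZMod (2 * n)) + 1) = α i₀ + ((2 * n / 3 : ℕ) : ZMod (2 * n)) by
            rw [mul_add, hxn, mul_one, add_comm],
        show α i₀ * (2 * ((2 * n / 3 : ℕ) : ZMod (2 * n)) + 1) =
            α i₀ + 2 * ((2 * n / 3 : ℕ) : ZMod (2 * n)) by linear_combination 2 * hxn,
        show α i₀ * (3 * ((2 * n / 3 : ℕ) : ZMod (2 * n)) - 3) = -3 * α i₀ by
            linear_combination 3 * hxn + h3K]
    · -- `x ≡ 2 (mod 3)`: the middle entries are exchanged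
      rw [univ_val_map_eq_of_distinct₆ α i₀ j₂ j₁ j₃ h02 h01 h03 h12.symm h23 h13, e1, e2, e3,
        stdThree]
      simp only [Multiset.insert_eq_cons, Multiset.map_cons, Multiset.map_singleton, IsUnit.unit_spec,
        mul_one]
      rw [show α i₀ * (((2 * n / 3 : ℕ) : ZMod (2 * n)) + 1) =
            α i₀ + 2 * ((2 * n / 3 : ℕ) : ZMod (2 * n)) by rw [mul_add, hxn, mul_one, add_comm],
        show α i₀ * (2 * ((2 * n / 3 : ℕ) : ZMod (2 * n)) + 1) =
            α i₀ + ((2 * n / 3 : ℕ) : ZMod (2 * n)) by linear_combination 2 * hxn + h3K,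
        show α i₀ * (3 * ((2 * n / 3 : ℕ) : ZMod (2 * n)) - 3) = -3 * α i₀ by
            linear_combination 3 * hxn + 2 * h3K]

/-! ### The multiset form: no exceptional quadruple at these levels -/

omit [NeZero n] in
/-- Divisibility of Meyer–Neutsch's `gcd(a₁, …, a_k, m)` (a right fold of `Nat.gcd`). [folklore] -/
private theorem dvd_foldr_gcd₆ {d b : ℕ} {l : Multiset ℕ} (hb : d ∣ b) (hl : ∀ v ∈ l, d ∣ v) :
    d ∣ l.foldr Nat.gcd b := by
  induction l using Multiset.induction_on with
  | empty => simpa using hb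
  | cons a l ih =>
    rw [Multiset.foldr_cons]
    exact Nat.dvd_gcd (hl a (Multiset.mem_cons_self a l))
      (ih fun v hv ↦ hl v (Multiset.mem_cons_of_mem hv))

omit [NeZero n] in
/-- A `4`-tuple whose multiset of values has no pair `a, -a` (as two members) is indecomposable.
[folklore] -/
private theorem indecomposable_of_not_hasPair₆ {m : ℕ} {α : Fin 4 → ZMod m}
    (h : ¬ HasPair (univ.val.map α)) : ∀ i j : Fin 4, i ≠ j → α i + α j ≠ 0 := by
  classical
  intro i j hij hsum
  apply h
  refine ⟨α i, Multiset.mem_map.mpr ⟨i, Finset.mem_univ_val i, rfl⟩, ?_⟩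
  have hneg : -α i = α j := by linear_combination (-1 : ZMod m) * hsum
  rw [hneg]
  by_cases he : α j = α i
  · have h2 : 2 ≤ Multiset.count (α i) (univ.val.map α) := by
      rw [count_univ_val_map]
      exact Finset.one_lt_card.mpr ⟨i, by simp, j, by simp [he], hij⟩
    rw [he, ← Multiset.count_pos, Multiset.count_erase_self]
    omega
  · exact (Multiset.mem_erase_of_ne he).mpr (Multiset.mem_map.mpr ⟨j, Finset.mem_univ_val j, rfl⟩)

omit [NeZero n] in
/-- At an EVEN level, Meyer–Neutsch primitivity `gcd(a₁, …, a₄, m) = 1` of the multiset of values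
of a Hodge character gives `GCD(aᵢ) = 1` in the letter of the named fact (a common divisor `g` of
the `aᵢ` divides `∑ aᵢ = 2m` and is prime to `m`, so `g ∣ 2`, and `g = 2` is not prime to the even
`m`). [cite: MeyerNeutsch1981Fermatquadrupel, (9)–(10) p. 52] -/
private theorem forall_dvd_of_isPrimitive_even₆ {α : Fin 4 → ZMod (2 * n)} (hα : IsHodge α)
    (hp : IsPrimitive (2 * n) (univ.val.map α)) : ∀ g : ℕ, (∀ i, g ∣ (α i).val) → g = 1 := by
  intro g hg
  have hsum : ∑ i, (α i).val = 2 * (2 * n) := by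
    have h1 := hα.2 1
    simp only [Units.val_one, one_mul] at h1
    change 2 * ∑ i, (α i).val = 2 * n * 4 at h1
    omega
  have hg4 : g ∣ 2 * (2 * n) := hsum ▸ Finset.dvd_sum fun i _ ↦ hg i
  have hcop : Nat.Coprime g (2 * n) := by
    have hd : Nat.gcd g (2 * n) ∣ ((univ.val.map α).map ZMod.val).foldr Nat.gcd (2 * n) := by
      refine dvd_foldr_gcd₆ (Nat.gcd_dvd_right _ _) fun v hv ↦ ?_
      obtain ⟨a, ha, rfl⟩ := Multiset.mem_map.mp hv
      obtain ⟨i, -, rfl⟩ := Multiset.mem_map.mp ha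
      exact (Nat.gcd_dvd_left _ _).trans (hg i)
    unfold IsPrimitive at hp
    rw [hp] at hd
    exact Nat.dvd_one.mp hd
  have hg2 : g ∣ 2 := hcop.dvd_of_dvd_mul_right hg4
  have hg0 : g ≠ 0 := fun h ↦ by
    rw [h] at hg2; exact absurd (Nat.eq_zero_of_zero_dvd hg2) two_ne_zero
  have hgle : g ≤ 2 := Nat.le_of_dvd two_pos hg2
  interval_cases g
  · exact absurd rfl hg0
  · rfl
  · exfalso
    have h2 : Nat.gcd 2 (2 * n) = 2 := Nat.gcd_eq_left (dvd_mul_right 2 n)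
    have h1 := Nat.Coprime.gcd_eq_one hcop
    rw [h2] at h1
    exact absurd h1 (by norm_num)

/-- **`Δ(m) = 0` at `m = 2n`, `n` odd, `3 ∥ n`, `n ∉ {51, 75}`, `n` carrying a prime `p ≥ 11` with
`n ≠ 3p`, or `p ≥ 5` with `p² ∣ n`: there is NO exceptional quadruple (Ausnahmequadrupel) at these
levels** — every Hodge `4`-multiset without a pair `a, -a` and with `gcd(a₁, …, a₄, m) = 1` is a unit
multiple of `L₁`, `L₂` or `L₃` ([Aoki1983, Thm. C] at these levels, in the vocabulary of
[MeyerNeutsch1981Fermatquadrupel] / [Shioda1982PicardFermat, Prop. 4]; the kernel sweeps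
`not_isExceptionalQuadruple_N` are the levels `N ≤ 180` and a few others, `PicardNumberSixPrime` is
`m = 6p`). [cite: Aoki1983, Thm. C] [cite: MeyerNeutsch1981Fermatquadrupel, p. 53 (Standard- und Ausnahmequadrupel)] -/
theorem not_isExceptionalQuadruple_twice_threeOdd (hnodd : Odd n) (hn3 : 3 ∣ n) (hn9 : ¬ 9 ∣ n)
    (hn51 : n ≠ 51) (hn75 : n ≠ 75) {p : ℕ} (hp : p.Prime) (hpn : p ∣ n)
    (hbig : (11 ≤ p ∧ n ≠ 3 * p) ∨ (5 ≤ p ∧ p ^ 2 ∣ n)) (s : Multiset (ZMod (2 * n))) :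
    haveI : NeZero (2 * n) := ⟨mul_ne_zero two_ne_zero (NeZero.ne n)⟩
    ¬ IsExceptionalQuadruple (2 * n) s := by
  haveI : NeZero (2 * n) := ⟨mul_ne_zero two_ne_zero (NeZero.ne n)⟩
  rintro ⟨h4, hs, hnp, hprim, hns⟩
  obtain ⟨r, α, rfl⟩ := exists_eq_univ_val_map s
  have hr : r = 4 := by rw [card_univ_val_map] at h4; exact h4
  subst hr
  have hα : IsHodge α := (isHodge_iff_isHodgeMultiset α).2 hs
  exact hns (isStandardQuadruple_of_twice_threeOdd hnodd hn3 hn9 hn51 hn75 hp hpn hbig hα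
    (indecomposable_of_not_hasPair₆ hnp) (forall_dvd_of_isPrimitive_even₆ hα hprim))

/-- **Aoki–Shioda 1983, Theorem `(𝔅²ₘ)` (ii) at the levels `m = 2n`, `n` odd, `3 ∥ n`, `n ∉ {51, 75}`,
`n` carrying a prime `p ≥ 11` with `n ≠ 3p`, or `p ≥ 5` with `p² ∣ n`, in the letter of the tree's
named fact `Literature.AlgebraicGeometry.HodgeTheory.AokiShioda1983_thmB2m_standard`:** every
indecomposable primitive Hodge character `α` of length `4` and level `m` is, after a permutation
of the coordinates, a) `(i, d + i, −2i, d)` or b) `(i, d + i, d + 2i, −4i)` with `m = 2d`, or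
c) `(j, d + j, 2d + j, −3j)` with `m = 3d` (`(i, d) = 1` resp. `(j, d) = 1`, and the printed side
conditions). This is the body of that fact at these `m` (for all such `m`, not only `m > 180`):
[Aoki1983, Thm. C] there (`isStandardQuadruple_of_twice_threeOdd`) and the generic bridge
`letter_of_isStandardQuadruple`. [cite: AokiShioda1983, §2 Theorem (𝔅²ₘ) (ii) a), b), c), p. 3] [cite: Aoki1983, Thm. C] -/
theorem thmB2m_standard_twice_threeOdd (m : ℕ) [NeZero m] (hm : m = 2 * n) (hnodd : Odd n)
    (hn3 : 3 ∣ n) (hn9 : ¬ 9 ∣ n) (hn51 : n ≠ 51) (hn75 : n ≠ 75) {p : ℕ} (hp : p.Prime)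
    (hpn : p ∣ n) (hbig : (11 ≤ p ∧ n ≠ 3 * p) ∨ (5 ≤ p ∧ p ^ 2 ∣ n)) (α : Fin 4 → ZMod m)
    (hα : IsHodge α) (hind : ∀ i j : Fin 4, i ≠ j → α i + α j ≠ 0)
    (hprim : ∀ g : ℕ, (∀ i, g ∣ (α i).val) → g = 1) :
    ∃ σ : Equiv.Perm (Fin 4),
      (∃ d i : ℕ, m = 2 * d ∧ 1 ≤ i ∧ i < d ∧ Nat.Coprime i d ∧ 4 * i ≠ m ∧
          ∀ k, α (σ k) = ![(i : ZMod m), (d : ZMod m) + i, -(2 * (i : ZMod m)), (d : ZMod m)] k) ∨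
      (∃ d i : ℕ, m = 2 * d ∧ 1 ≤ i ∧ i < d ∧ Nat.Coprime i d ∧ 3 * i ≠ m ∧ 4 * i ≠ m ∧ 6 * i ≠ m ∧
          ∀ k, α (σ k) = ![(i : ZMod m), (d : ZMod m) + i, (d : ZMod m) + 2 * i, -(4 * (i : ZMod m))] k) ∨
      (∃ d j : ℕ, m = 3 * d ∧ 1 ≤ j ∧ j < d ∧ Nat.Coprime j d ∧ 6 * j ≠ m ∧
          ∀ k, α (σ k) = ![(j : ZMod m), (d : ZMod m) + j, 2 * (d : ZMod m) + j, -(3 * (j : ZMod m))] k) := by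
  subst hm
  exact letter_of_isStandardQuadruple hα.1.1 hind
    (isStandardQuadruple_of_twice_threeOdd hnodd hn3 hn9 hn51 hn75 hp hpn hbig hα hind hprim)

end TwiceThreeOdd

end Literature.AlgebraicGeometry.Shioda1982
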